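import Summits.CriticalPhenomena.PercolationContinuityZ3.Theorems.PercNearOneGluingNoHeavyLowerTailTopPacking
import Summits.CriticalPhenomena.PercolationContinuityZ3.Theorems.PercNearOneGluingNoHeavyLowerTailTopWeightHardness
import HarnessLib

/-!
# `NoHeavyLowerTail` (stmt-CriticalPhenomena-4575) — CALIBRATION: the top packing with right-hand side `μ(o ↔ A)`
# ("TP(Ω)", = the full prefix block-credit inequality PBCR(A) of `prim-gen-swap`) implies Kozma–Nitzan's Conjecture 1

Support file (lemma factory `prim-lf-8`, gen 2; `--supports stmt-CriticalPhenomena-4575`).  No definitions, no named facts,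
no sorries.  Notation of `…TopPacking`: relays `A`, observer `o ∉ A`, level `j`, `R_x = {|π(x)| ≤ j}`, `S(x) = μ(R_x)`,
`L = {1 ≤ N ≤ j}`, a ranking `rk` injective on `A` with `S` non-increasing along it, `W_x = L ∩ {o ↔ x} ∩ {o ↮ rk-earlier relays}`
("`top(π(o)) = x`").

* `TP   :  Σ_x μ(W_x)/S(x) ≤ 1`            — additive (hub shadow = kcluster's WF); `Theorems.noHeavyLowerTail_of_topPacking`.
* `TP(Ω):  Σ_x μ(W_x)/S(x) ≤ μ(o ↔ A)`      — prim-gen-swap's PBCR for the full prefix `W = A` (MAX-TRANSFER.md §2; its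
  `|W| = 2` case is the theorem `prefixPacking_two`); level `j = 1` is Kozma–Nitzan's Lemma 2 with its printed right-hand
  side `φ(X) = P(0 ↔ A(X))`.  0 violations in every census so far.

This file PROVES that `TP(Ω)` — even only at the exact half level `|A| = 2j + 1` and only for the canonical ranking — implies
the PRODUCT form `CIL' : μ(o ↔ A)·μ(R_cᶜ) ≤ μ(R_oᶜ)` of `…TopWeightHardness` on the same instance
(`productIsolation_of_topPackingOmega`: `μ(L) = Σ_x S(x)·(μ(W_x)/S(x)) ≤ S(c)·μ(o ↔ A)` and `μ(o ↔ A) = μ(L) + μ(R_oᶜ)`), hence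
Kozma–Nitzan's Conjecture 1 (`kozmaNitzan_conjecture1_of_topPackingOmega`, through
`Theorems.kozmaNitzan_conjecture1_of_productIsolation`).  So `TP(Ω)`/PBCR(A) is NOT an intermediate target for the general
crux ladder, whereas `TP` is (seat memo run/shared/lean/prim/prim-lf-8/CALIBRATION-LF8.md: the hub obstruction bites exactly in
the cells `j ≥ 3, k ≥ j + 4`; the rungs `(5,2)` and `(6,3)` are unobstructed).  Consequence recorded there: a Kozma–Nitzan-template
proof of `TP_j` (termwise transfer into one decreasing conditioning world + disjointness) would prove `TP(Ω)`, i.e. Conjecture 1.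
-/

noncomputable section

namespace Summit.CriticalPhenomena.PercolationContinuityZ3.Theorems

open MeasureTheory Set Literature.Probability.LatticeModels Literature.Probability.Percolation
open scoped Classical BigOperators

variable {n : ℕ}

open TopPacking GuardedTopPacking TopWeightHardness in
/-- **TP(Ω) ⇒ CIL'** on the same instance: if `Σ_x μ(W_x)/S(x) ≤ μ(o ↔ A)` for the canonical `S`-ranking and `c` is a
champion (`S(a) ≤ S(c)` for all `a ∈ A`; `c ∈ A` is not even needed), then `μ(o ↔ A)·μ(R_cᶜ) ≤ μ(R_oᶜ)`. -/
theorem productIsolation_of_topPackingOmega (w : Sym2 (Fin n) → unitInterval) (A : Finset (Fin n)) (o c : Fin n)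
    (j : ℕ)
    (hchamp : ∀ a ∈ A,
      (prodBernoulli w).real {ω : BondConfig (Fin n) | (A.filter fun z => ω ∈ openConn a z).card ≤ j} ≤
        (prodBernoulli w).real {ω : BondConfig (Fin n) | (A.filter fun z => ω ∈ openConn c z).card ≤ j})
    (hTPΩ : ∀ (rk : Fin n → ℕ), Set.InjOn rk ↑A →
      (∀ x ∈ A, ∀ y ∈ A, rk x < rk y →
        (prodBernoulli w).real {ω : BondConfig (Fin n) | (A.filter fun z => ω ∈ openConn y z).card ≤ j} ≤
          (prodBernoulli w).real {ω : BondConfig (Fin n) | (A.filter fun z => ω ∈ openConn x z).card ≤ j}) →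
      ∑ x ∈ A,
        (prodBernoulli w).real
            ({ω : BondConfig (Fin n) | 1 ≤ (A.filter fun z => ω ∈ openConn o z).card ∧
                (A.filter fun z => ω ∈ openConn o z).card ≤ j} ∩
              {ω | ω ∈ openConn o x} ∩ {ω | ∀ y ∈ A, rk y < rk x → ω ∉ openConn o y}) /
          (prodBernoulli w).real {ω : BondConfig (Fin n) | (A.filter fun z => ω ∈ openConn x z).card ≤ j} ≤
      (prodBernoulli w).real {ω : BondConfig (Fin n) | ∃ b ∈ A, ω ∈ openConn o b}) :
    (prodBernoulli w).real {ω : BondConfig (Fin n) | ∃ b ∈ A, ω ∈ openConn o b} *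
        (prodBernoulli w).real {ω : BondConfig (Fin n) | (A.filter fun z => ω ∈ openConn c z).card ≤ j}ᶜ ≤
      (prodBernoulli w).real {ω : BondConfig (Fin n) | (A.filter fun z => ω ∈ openConn o z).card ≤ j}ᶜ := by
  set μ := prodBernoulli w with hμ
  have hmeas : ∀ S : Set (BondConfig (Fin n)), MeasurableSet S := fun S => (Set.toFinite S).measurableSet
  set S : Fin n → ℝ := fun x =>
    μ.real {ω : BondConfig (Fin n) | (A.filter fun z => ω ∈ openConn x z).card ≤ j} with hS
  set rk : Fin n → ℕ := fun x => (A.filter fun z => S x < S z ∨ (S z = S x ∧ z < x)).card with hrk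
  have hinj : Set.InjOn rk ↑A := rank_injOn A S
  have hanti : ∀ x ∈ A, ∀ y ∈ A, rk x < rk y → S y ≤ S x :=
    fun x hx y hy h => rank_antitone A S hx hy h
  set W : Fin n → Set (BondConfig (Fin n)) := fun x =>
    ({ω : BondConfig (Fin n) | 1 ≤ (A.filter fun z => ω ∈ openConn o z).card ∧
        (A.filter fun z => ω ∈ openConn o z).card ≤ j} ∩
      {ω | ω ∈ openConn o x} ∩ {ω | ∀ y ∈ A, rk y < rk x → ω ∉ openConn o y}) with hW
  set J : ℝ := μ.real {ω : BondConfig (Fin n) | ∃ b ∈ A, ω ∈ openConn o b} with hJ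
  have hpack : ∑ x ∈ A, μ.real (W x) / S x ≤ J := hTPΩ rk hinj hanti
  have hsum := real_L_eq_sum w A o j rk hinj
  have hterm : ∀ x ∈ A, μ.real (W x) ≤ S c * (μ.real (W x) / S x) := by
    intro x hx
    have hWle : μ.real (W x) ≤ S x := measureReal_mono (W_subset_R A o x j rk) (measure_ne_top _ _)
    have hS0 : 0 ≤ S x := measureReal_nonneg
    rcases eq_or_lt_of_le hS0 with h0 | hpos
    · have hW0 : μ.real (W x) = 0 := le_antisymm (h0 ▸ hWle) measureReal_nonneg
      rw [hW0]; simp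
    · calc μ.real (W x) = S x * (μ.real (W x) / S x) := by field_simp
        _ ≤ S c * (μ.real (W x) / S x) :=
          mul_le_mul_of_nonneg_right (hchamp x hx) (div_nonneg measureReal_nonneg hS0)
  -- μ(L) ≤ S(c)·μ(o ↔ A)
  have hL : μ.real {ω : BondConfig (Fin n) | 1 ≤ (A.filter fun z => ω ∈ openConn o z).card ∧
      (A.filter fun z => ω ∈ openConn o z).card ≤ j} ≤ S c * J := by
    calc μ.real {ω : BondConfig (Fin n) | 1 ≤ (A.filter fun z => ω ∈ openConn o z).card ∧
              (A.filter fun z => ω ∈ openConn o z).card ≤ j}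
        = ∑ x ∈ A, μ.real (W x) := hsum
      _ ≤ ∑ x ∈ A, S c * (μ.real (W x) / S x) := Finset.sum_le_sum hterm
      _ = S c * ∑ x ∈ A, μ.real (W x) / S x := by rw [Finset.mul_sum]
      _ ≤ S c * J := mul_le_mul_of_nonneg_left hpack measureReal_nonneg
  -- μ(o ↔ A) = μ(L) + μ(R_oᶜ) and μ(R_cᶜ) = 1 - S(c)
  have hjoin := real_join_eq w A o j
  have hcompl : μ.real {ω : BondConfig (Fin n) | (A.filter fun z => ω ∈ openConn c z).card ≤ j}ᶜ = 1 - S c :=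
    probReal_compl_eq_one_sub (hmeas _)
  rw [hcompl]
  have hJ0 : 0 ≤ J := measureReal_nonneg
  nlinarith [hL, hjoin, hJ0]

/-- **TP(Ω) (alias PBCR(A)) ⇒ Kozma–Nitzan Conjecture 1.**  If on every finite weighted graph, for every relay set at the
exact half level `|A| = 2j + 1`, every observer `o ∉ A` and every `S`-antitone ranking injective on `A`, the top packing with
right-hand side `μ(o ↔ A)` holds, then for every `(G, A, o, b)` and `t ≤ min_{a∈A} μ(a ↔ b)`: `μ(o ↔ A)·t ≤ μ(o ↔ b)`
(the min-free typing of `KozmaNitzan2024_conjecture1`).  Via `productIsolation_of_topPackingOmega` and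
`Theorems.kozmaNitzan_conjecture1_of_productIsolation`. -/
theorem kozmaNitzan_conjecture1_of_topPackingOmega
    (hTPΩ : ∀ (n : ℕ) (w : Sym2 (Fin n) → unitInterval) (A : Finset (Fin n)) (o : Fin n) (j : ℕ)
      (rk : Fin n → ℕ), o ∉ A → 2 * j + 1 = A.card → Set.InjOn rk ↑A →
      (∀ x ∈ A, ∀ y ∈ A, rk x < rk y →
        (prodBernoulli w).real {ω : BondConfig (Fin n) | (A.filter fun z => ω ∈ openConn y z).card ≤ j} ≤
          (prodBernoulli w).real {ω : BondConfig (Fin n) | (A.filter fun z => ω ∈ openConn x z).card ≤ j}) →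
      ∑ x ∈ A,
        (prodBernoulli w).real
            ({ω : BondConfig (Fin n) | 1 ≤ (A.filter fun z => ω ∈ openConn o z).card ∧
                (A.filter fun z => ω ∈ openConn o z).card ≤ j} ∩
              {ω | ω ∈ openConn o x} ∩ {ω | ∀ y ∈ A, rk y < rk x → ω ∉ openConn o y}) /
          (prodBernoulli w).real {ω : BondConfig (Fin n) | (A.filter fun z => ω ∈ openConn x z).card ≤ j} ≤
      (prodBernoulli w).real {ω : BondConfig (Fin n) | ∃ b ∈ A, ω ∈ openConn o b}) :
    ∀ (n : ℕ) (w : Sym2 (Fin n) → unitInterval) (A : Finset (Fin n)) (o b : Fin n) (t : ℝ),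
      (∀ a ∈ A, t ≤ (prodBernoulli w).real (openConn a b)) →
        (prodBernoulli w).real (⋃ a ∈ A, openConn o a) * t ≤ (prodBernoulli w).real (openConn o b) :=
  kozmaNitzan_conjecture1_of_productIsolation fun n w A o c j ho _ hcard hchamp =>
    productIsolation_of_topPackingOmega w A o c j hchamp
      (fun rk hinj hanti => hTPΩ n w A o j rk ho hcard hinj hanti)

end Summit.CriticalPhenomena.PercolationContinuityZ3.Theorems

end
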